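import Summits.NavierStokesRegularity.NavierStokesRegularity.Theorems.TerminalTraceTypeITraceScarL3SqrtTwoApexCloser
import Summits.NavierStokesRegularity.NavierStokesRegularity.Theorems.TerminalTraceTypeITraceScarL3SqrtTwoApexWindow
import Summits.NavierStokesRegularity.NavierStokesRegularity.Theorems.TerminalTraceTypeITraceScarL3ExtinctApexDOfL3TraceConst
import HarnessLib

/-!
# The √2-APEX WINDOW, UNCONDITIONAL (ROUND-27 T27-B, T27-C): no top singular point when `C² < 2`, the LOUD stub
# in the window, and ITEM 18385 for blow-ups with eventual Type-I constant `C² < 2ν`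
# (item `TerminalTrace.TypeITraceScarL3`, stmt-NavierStokesRegularity-18385, Stub LOUD line; helpers)

Seat nsreg-C26-p1 g2 (cell ns-regularity-ideate), `--supports stmt-NavierStokesRegularity-18385` (helper).
The conditional records of `…SqrtTwoApexWindow` fed with T27-A (`two_le_rateSq_of_quietShell`,
`…SqrtTwoApexCloser`) and the constant-exposed Stub 2′ (`extinctApexD_of_L3trace_const`):

* `topSingularSet_eq_empty_of_rateSq_lt_two` — **T27-B**: an extinct Type-I apex package of class `(M, D₀, C)`
  with `C² < 2` has EMPTY top singular set (pointwise: `no_topSingular_of_rateSq_lt_two two_le_rateSq_of_quietShell`;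
  the registered LOUD stub in the window: `stub_no_loudShellExtinctApex_of_rateSq_lt_two two_le_rateSq_of_quietShell`).
* `typeITraceScarL3_of_eventualRate_sq_lt_two_nu` — **T27-C = ITEM 18385 IN THE WINDOW**: a classical
  Leray–Hopf flow on `[0,T)` blowing up at `T` with EVENTUAL TYPE-I CONSTANT `C`, `C² < 2ν`
  (`‖u(t,x)‖ ≤ C/√(T−t)` for `t` near `T`), leaves no `L³` scar: at every singular point `x₀`
  (`‖u‖_{L^∞(Q_r(T,x₀))} = ∞` for all `r`), `u(T) ∉ L³(B(x₀, ρ))` for every `ρ > 0`.  In print the constant at a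
  Type-I blow-up is only known to be `≥ √ν/(8γ₃)` (Leray 1934); the window `[0.11√ν, √(2ν))` is new.

WHAT THIS IS NOT: not Stub LOUD (all constants), not item 18385 (all Type-I blow-ups), NOT a proof of
Navier–Stokes regularity — statements about hypothetical blow-ups whose eventual Type-I constant lies below
`√(2ν)`.  [folklore; Ghidaglia 1986; CaffarelliKohnNirenberg1982 Thm B; Leray1934; Seregin2014 Prop. 6.20]
-/

noncomputable section

set_option linter.dupNamespace false

namespace Summit.NavierStokesRegularity.NavierStokesRegularity.Theorems.TypeITraceScarL3

open MeasureTheory Set Function Filter Topology Metric InnerProductSpace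
open Literature.Analysis Literature.Analysis.FluidPDE
open scoped NNReal ENNReal RealInnerProductSpace ContDiff

/-- **T27-B, unconditional: the top singular set of an extinct Type-I apex package with `C² < 2` is EMPTY.**
(Pointwise form: `no_topSingular_of_rateSq_lt_two two_le_rateSq_of_quietShell …`; the registered LOUD stub in
the window is `stub_no_loudShellExtinctApex_of_rateSq_lt_two two_le_rateSq_of_quietShell`.)
[folklore; CaffarelliKohnNirenberg1982 Thm B] -/
theorem topSingularSet_eq_empty_of_rateSq_lt_two {M D₀ : ℝ≥0} {C : ℝ}
    {U : ℝ → EuclideanSpace ℝ (Fin 3) → EuclideanSpace ℝ (Fin 3)}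
    {P : ℝ → EuclideanSpace ℝ (Fin 3) → ℝ}
    {G : ℝ → EuclideanSpace ℝ (Fin 3) → EuclideanSpace ℝ (Fin 3) →L[ℝ] EuclideanSpace ℝ (Fin 3)}
    (hsw : ∀ a : ℝ, 0 < a →
      IsSuitableWeakSolutionInBall a (0 : ℝ × EuclideanSpace ℝ (Fin 3)) U P)
    (hG : ∀ a : ℝ, 0 < a →
      HasWeakSpatialGradientOn
        (parabolicCylinderOpens a (0 : ℝ × EuclideanSpace ℝ (Fin 3))) U G)
    (hI : ∀ a : ℝ, 0 < a →
      typeIBound (parabolicCylinder a (0 : ℝ × EuclideanSpace ℝ (Fin 3))) U P G ≤ M)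
    (hD : ∀ z₀ : ℝ × EuclideanSpace ℝ (Fin 3), z₀.1 ≤ 0 →
      ∀ r : ℝ, 0 < r → cknD r z₀ P ≤ D₀)
    (hrate : ∀ s : ℝ, s < 0 →
      ∀ᵐ y : EuclideanSpace ℝ (Fin 3), ‖U s y‖ ≤ C / Real.sqrt (-s))
    (htop : ∀ φ : EuclideanSpace ℝ (Fin 3) → EuclideanSpace ℝ (Fin 3),
      ContDiff ℝ (⊤ : ℕ∞) φ →
      HasCompactSupport φ → ∀ ε : ℝ, 0 < ε →
      ∃ s₀ : ℝ, s₀ < 0 ∧ ∀ᵐ s ∂(volume.restrict (Ioo s₀ 0)), |∫ y, ⟪U s y, φ y⟫| ≤ ε)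
    (hC : C ^ 2 < 2) :
    {x : EuclideanSpace ℝ (Fin 3) | IsBackwardSingularPoint U ((0 : ℝ), x)} = ∅ :=
  Set.eq_empty_of_forall_notMem fun x hx =>
    no_topSingular_of_rateSq_lt_two two_le_rateSq_of_quietShell hsw hG hI hD hrate htop hC x hx

/-- **T27-C = ITEM 18385 IN THE CONSTANT WINDOW, unconditional** (module docstring): a classical Leray–Hopf
flow blowing up at `T` with eventual Type-I constant `C`, `C² < 2ν`, leaves no `L³` scar at any singular point.
[folklore; Ghidaglia 1986; CaffarelliKohnNirenberg1982 Thm B; Leray1934; Seregin2014 Prop. 6.20] -/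
theorem typeITraceScarL3_of_eventualRate_sq_lt_two_nu :
    ∀ (ν T : ℝ), 0 < ν → 0 < T →
      ∀ (u : ℝ → EuclideanSpace ℝ (Fin 3) → EuclideanSpace ℝ (Fin 3))
        (p : ℝ → EuclideanSpace ℝ (Fin 3) → ℝ),
      IsClassicalNSSolutionOn (Ico 0 T) ν 0 u p → IsLerayHopfOn T ν 0 (u 0) u →
      ∀ C : ℝ, C ^ 2 < 2 * ν → (∀ᶠ t in 𝓝[<] T, ∀ x, ‖u t x‖ ≤ C / Real.sqrt (T - t)) →
      ∀ x₀ : EuclideanSpace ℝ (Fin 3),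
      (∀ r : ℝ, 0 < r →
        eLpNorm (uncurry u) ⊤ (volume.restrict (parabolicCylinder r (T, x₀))) = ⊤) →
      ∀ ρ : ℝ, 0 < ρ → ¬ MemLp (u T) 3 (volume.restrict (ball x₀ ρ)) :=
  typeITraceScarL3_of_rateSq_lt_two_nu two_le_rateSq_of_quietShell extinctApexD_of_L3trace_const

end Summit.NavierStokesRegularity.NavierStokesRegularity.Theorems.TypeITraceScarL3

end
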